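import Summits.ABC.IUTFork.Cor312PinnedHonestInflation
import HarnessLib

/-!
# [IUTchIII] Cor. 3.12 — the inflation budget WITHOUT the pins, and its TWO CHANNELS ((Ind1)(Ind2)+hull vs (Ind3))

Proof-only record file (D-0012; abc-iut cell, wave 4, seat abc-iut-w4-d103 gen 3, PR-3 lineage). Companion of
`Cor312PinnedHonestInflation` (p425829) and `…Placewise` (p427951), written for the IUT REPAIR branch's class (i) lane (abc-iut-rp-d2:
log-Kummer / log-shell UPPER SEMI-COMPATIBILITY = (Ind3) candidates, [IUTchIII] Prop. 3.5 / Thm. 3.11 (ii)) and the barrier track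
(abc-iut-rp-bar BAR-S). TAKES NO SIDE on [IUTchIII] Cor. 3.12; NO definition, NO `Prop` fact; inline hypotheses; nothing frozen edited.
[IUTchIII] kurims [corpus:book:anonnd-inter-universal-teichmuller-theory-iii]: Cor. 3.12 p. 173 l. 41 – p. 174 l. 19; (Ind3) p. 156
l. 33–40 («as one varies m ∈ ℤ, the isomorphisms … are "upper semi-compatible"»); (xi-e)/(xi-f) p. 183 l. 43 – p. 184 l. 29.
[IUTchIV] Thm. 1.10 Step (v) [corpus:book:anonnd-inter-universal-teichmuller-theory-iv p. 27 l. 57 – p. 28 l. 5]. [claim: Mochizuki2012, status: disputed]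

WHY. p425829's honest-setting identity reads the Θ-side through the one-operator Θ-pin (pΘ), which COLLAPSES (Ind3)
(`thetaRegion3_eq_of_thetaPinned`: the (Ind3)-union of Kummer images is the single region `ρ Ψ_n` — PR-3 finding d103-F2, the pin is
STRONGER-THAN-PRINT on the Θ-side in exactly this respect). This file separates what does NOT need the pin:
* §1 `height_le_of_excessCap` / `not_statement_of_excessCap_lt` — PIN-FREE, HONESTY-FREE: for EVERY setting with `ThetaFinite` and a
  label-independent q-volume, the typed Corollary and ANY packetwise cap `logvol ⁿ˒°𝒰_{j,v} − j²·qLocal_{j,v} ≤ s_j(v)` give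
  `(PN(j²) − 1)·|log(q)| ≤ PN(Σᶠ s)`; a cap of total below that budget refutes the typed Corollary. (Honesty enters only when one READS
  `j²·qLocal` as the volume of the `j`-th Θ-value's Kummer image.)
* §2 the TWO CHANNELS: `hullvol − j²·q = [logvol ⁿ˒°𝒰 − logvol thetaRegion3]` (the (Ind1),(Ind2)-union + holomorphic hull — channel 12)
  `+ [logvol thetaRegion3 − j²·q]` (the (Ind3)-union of Kummer images over the honest single image — channel 3);
  `statement_iff_twoChannel`: Statement ⟺ budget ≤ PN(Σᶠ channel 12) + PN(Σᶠ channel 3) (finite supports from `BridgeHyps.image_fin`,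
  `thetaRegion3Vol_support_finite`); `ind3Channel_eq_zero_of_thetaPinned`: under (pΘ)+`KummerB`+honest scaling channel 3 ≡ 0 (the
  collapse, quantified); `ind3Channel_nonneg_of_honestImage`: with monotone volume and ONE honestly-scaled Kummer image inside the
  (Ind3)-union, channel 3 ≥ 0.
* §3 `not_statement_of_channelCaps_lt`: caps `s₁₂`, `s₃` on the two channels with PN(Σᶠ (s₁₂ + s₃)) below the budget refute the typed
  Corollary — so a class (i) repair acting through (Ind3) («upper semi-compatibility») must make the (Ind3)-UNION of Kummer images carry,
  on procession-average, `j²·(q-volume) +` a HEIGHT-SIZED excess: any (Ind3)-gain bounded by log-shell data ([IUTchIV] Prop. 1.4: the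
  images lie in the log-shell) is insufficient at large `|log(q)|` unless channel 12 supplies the rest. Nothing asserted; typed ≠ proved.
-/

noncomputable section

open Set

namespace Summit.ABC.IUTFork.Cor312Vol.PinnedHonest

open Thm311 Cor312 Cor312Vol Literature.IUT.LogThetaLattice

variable {T : ThetaIndex} (S : LatticeSituation T) (P : Cor312.Setting S.toSituation)
  (ρ : (∀ v : T.V, v ∈ T.Vbad → Set (S.L.StarPacket v)) → ∀ (j : T.Label) (vQ : T.VQ), Set (S.L.Packet j vQ))

/-! ## 1. Pin-free, honesty-free: any cap on the weighted excess bounds `|log(q)|` -/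

/-- **PIN-FREE CAP THEOREM.** For EVERY setting with `ThetaFinite` and a label-independent q-volume: if in every packet at a label
`j = i+1 ∈ 𝔽_l^⋇` the weighted excess `logvol ⁿ˒°𝒰_{j,v_ℚ} − j²·qLocal_{j,v_ℚ}` is at most `s i v_ℚ` (finitely supported in `v_ℚ`), then the
typed Corollary forces `(PN(j²) − 1)·(−(−|log(q)|)) ≤ PN(i ↦ Σᶠ_{v_ℚ} s i v_ℚ)`. No pin, no honesty, no bridge hypothesis.
[claim: Mochizuki2012, status: disputed] -/
theorem height_le_of_excessCap (hfin : P.ThetaFinite)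
    (hindep : ∀ (i i' : Fin T.lstar) (vQ : T.VQ), P.qLocal (Setting.labelSucc i) vQ = P.qLocal (Setting.labelSucc i') vQ)
    (s : Fin T.lstar → T.VQ → ℝ) (hs : ∀ i, (Function.support (s i)).Finite)
    (hcap : ∀ (i : Fin T.lstar) (vQ : T.VQ),
      (S.D P.n).logvol _ vQ (P.thetaHull (Setting.labelSucc i) vQ) -
        (((i : ℕ) + 1 : ℕ) : ℝ) ^ 2 * P.qLocal (Setting.labelSucc i) vQ ≤ s i vQ)
    (hS : P.Statement) :
    (processionNormalized (fun i : Fin T.lstar => (((i : ℕ) + 1 : ℕ) : ℝ) ^ 2) - 1) * (-P.negLogQ) ≤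
      processionNormalized (fun i : Fin T.lstar => ∑ᶠ vQ : T.VQ, s i vQ) := by
  have h := (statement_iff_weightedExcess S P hfin hindep).1 hS
  refine h.trans (Cor312Vol.processionNormalized_mono fun i => ?_)
  have hq : (Function.support fun vQ : T.VQ => P.qLocal (Setting.labelSucc i) vQ).Finite := P.qSupport_finite _
  have hwq : (Function.support fun vQ : T.VQ =>
      (((i : ℕ) + 1 : ℕ) : ℝ) ^ 2 * P.qLocal (Setting.labelSucc i) vQ).Finite :=
    hq.subset (Function.support_mul_subset_right _ _)
  have hex : (Function.support fun vQ : T.VQ =>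
      (S.D P.n).logvol _ vQ (P.thetaHull (Setting.labelSucc i) vQ) -
        (((i : ℕ) + 1 : ℕ) : ℝ) ^ 2 * P.qLocal (Setting.labelSucc i) vQ).Finite :=
    Function.HasFiniteSupport.sub (hullVol_support_finite S P hfin i) hwq
  exact finsum_le_finsum' hex (hs i) fun vQ => hcap i vQ

/-- **PIN-FREE HEIGHT NO-GO**: a weighted-excess cap of procession-normalized total below the budget `(PN(j²) − 1)·|log(q)|` REFUTES the
typed Corollary, on every setting with `ThetaFinite` and a label-independent q-volume. [claim: Mochizuki2012, status: disputed] -/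
theorem not_statement_of_excessCap_lt (hfin : P.ThetaFinite)
    (hindep : ∀ (i i' : Fin T.lstar) (vQ : T.VQ), P.qLocal (Setting.labelSucc i) vQ = P.qLocal (Setting.labelSucc i') vQ)
    (s : Fin T.lstar → T.VQ → ℝ) (hs : ∀ i, (Function.support (s i)).Finite)
    (hcap : ∀ (i : Fin T.lstar) (vQ : T.VQ),
      (S.D P.n).logvol _ vQ (P.thetaHull (Setting.labelSucc i) vQ) -
        (((i : ℕ) + 1 : ℕ) : ℝ) ^ 2 * P.qLocal (Setting.labelSucc i) vQ ≤ s i vQ)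
    (hlt : processionNormalized (fun i : Fin T.lstar => ∑ᶠ vQ : T.VQ, s i vQ) <
      (processionNormalized (fun i : Fin T.lstar => (((i : ℕ) + 1 : ℕ) : ℝ) ^ 2) - 1) * (-P.negLogQ)) :
    ¬ P.Statement := fun hS =>
  (not_le.mpr hlt) (height_le_of_excessCap S P hfin hindep s hs hcap hS)

/-! ## 2. The two channels of inflation -/

/-- Under the bridge hypotheses the volume of the (Ind3)-enlarged Θ-region `thetaRegion3` is finitely supported over `v_ℚ` at every label
of `𝔽_l^⋇` (it is a possible image; `BridgeHyps.image_fin` along the global choice «(Ind3)-enlarged region everywhere»). [folklore] -/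
theorem thetaRegion3Vol_support_finite (HB : BridgeHyps P) (i : Fin T.lstar) :
    (Function.support fun vQ : T.VQ =>
      (S.D P.n).logvol _ vQ (P.thetaRegion3 (Setting.labelSucc i) vQ)).Finite := by
  have hl : (1 / (T.lstar : ℝ)) ≠ 0 :=
    one_div_ne_zero (by exact_mod_cast (lt_of_lt_of_le (by norm_num) T.two_le_lstar).ne')
  let U : ImageChoice P := ⟨fun t => P.thetaRegion3 _ t.2, fun t => P.thetaRegion3_mem_possibleImages _ t.2⟩
  have hU := HB.image_fin U
  have hpre := hU.preimage (f := fun vQ : T.VQ => (i, vQ)) fun x _ y _ h => (Prod.ext_iff.mp h).2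
  refine hpre.subset fun vQ hvQ => ?_
  simp only [Set.mem_preimage, Function.mem_support] at hvQ ⊢
  exact mul_ne_zero hl hvQ

/-- **THE TWO-CHANNEL IDENTITY.** For every setting with `ThetaFinite`, a label-independent q-volume and finitely supported
`thetaRegion3`-volumes (e.g. from `BridgeHyps`, `thetaRegion3Vol_support_finite`):
`Statement ⟺ (PN(j²) − 1)·(−(−|log(q)|)) ≤ PN(Σᶠ [logvol ⁿ˒°𝒰 − logvol thetaRegion3]) + PN(Σᶠ [logvol thetaRegion3 − j²·qLocal])` — channel 12
(the (Ind1),(Ind2)-union and the holomorphic hull) plus channel 3 (the (Ind3)-union of Kummer images over the honest single-image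
volume). Pure rearrangement of p425829's `statement_iff_weightedExcess`. [claim: Mochizuki2012, status: disputed] -/
theorem statement_iff_twoChannel (hfin : P.ThetaFinite)
    (hindep : ∀ (i i' : Fin T.lstar) (vQ : T.VQ), P.qLocal (Setting.labelSucc i) vQ = P.qLocal (Setting.labelSucc i') vQ)
    (hR : ∀ i : Fin T.lstar, (Function.support fun vQ : T.VQ =>
      (S.D P.n).logvol _ vQ (P.thetaRegion3 (Setting.labelSucc i) vQ)).Finite) :
    P.Statement ↔
      (processionNormalized (fun i : Fin T.lstar => (((i : ℕ) + 1 : ℕ) : ℝ) ^ 2) - 1) * (-P.negLogQ) ≤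
        processionNormalized (fun i : Fin T.lstar =>
          ∑ᶠ vQ : T.VQ, ((S.D P.n).logvol _ vQ (P.thetaHull (Setting.labelSucc i) vQ) -
            (S.D P.n).logvol _ vQ (P.thetaRegion3 (Setting.labelSucc i) vQ))) +
        processionNormalized (fun i : Fin T.lstar =>
          ∑ᶠ vQ : T.VQ, ((S.D P.n).logvol _ vQ (P.thetaRegion3 (Setting.labelSucc i) vQ) -
            (((i : ℕ) + 1 : ℕ) : ℝ) ^ 2 * P.qLocal (Setting.labelSucc i) vQ)) := by
  rw [statement_iff_weightedExcess S P hfin hindep]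
  have hsplit : ∀ i : Fin T.lstar,
      (∑ᶠ vQ : T.VQ, ((S.D P.n).logvol _ vQ (P.thetaHull (Setting.labelSucc i) vQ) -
          (((i : ℕ) + 1 : ℕ) : ℝ) ^ 2 * P.qLocal (Setting.labelSucc i) vQ)) =
        (∑ᶠ vQ : T.VQ, ((S.D P.n).logvol _ vQ (P.thetaHull (Setting.labelSucc i) vQ) -
            (S.D P.n).logvol _ vQ (P.thetaRegion3 (Setting.labelSucc i) vQ))) +
          ∑ᶠ vQ : T.VQ, ((S.D P.n).logvol _ vQ (P.thetaRegion3 (Setting.labelSucc i) vQ) -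
            (((i : ℕ) + 1 : ℕ) : ℝ) ^ 2 * P.qLocal (Setting.labelSucc i) vQ) := by
    intro i
    have hq : (Function.support fun vQ : T.VQ => P.qLocal (Setting.labelSucc i) vQ).Finite := P.qSupport_finite _
    have hwq : (Function.support fun vQ : T.VQ =>
        (((i : ℕ) + 1 : ℕ) : ℝ) ^ 2 * P.qLocal (Setting.labelSucc i) vQ).Finite :=
      hq.subset (Function.support_mul_subset_right _ _)
    have h1 : (Function.support fun vQ : T.VQ =>
        (S.D P.n).logvol _ vQ (P.thetaHull (Setting.labelSucc i) vQ) -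
          (S.D P.n).logvol _ vQ (P.thetaRegion3 (Setting.labelSucc i) vQ)).Finite :=
      Function.HasFiniteSupport.sub (hullVol_support_finite S P hfin i) (hR i)
    have h2 : (Function.support fun vQ : T.VQ =>
        (S.D P.n).logvol _ vQ (P.thetaRegion3 (Setting.labelSucc i) vQ) -
          (((i : ℕ) + 1 : ℕ) : ℝ) ^ 2 * P.qLocal (Setting.labelSucc i) vQ).Finite :=
      Function.HasFiniteSupport.sub (hR i) hwq
    rw [← finsum_add_distrib h1 h2]
    exact finsum_congr fun vQ => by ring
  simp only [hsplit]
  unfold processionNormalized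
  rw [Finset.sum_add_distrib, add_div]

/-- **The Θ-pin CLOSES channel 3** (PR-3 finding d103-F2, quantified): under the one-operator Θ-pin (pΘ), Thm. 3.11 (ii)(b) `KummerB`
and honest `j²`-scaling of the pinned image, the (Ind3)-union IS the single honest image, so `logvol thetaRegion3 − j²·qLocal = 0` in
every packet — the two-channel identity then reduces to p425829's. [claim: Mochizuki2012, status: disputed] -/
theorem ind3Channel_eq_zero_of_thetaPinned (hKumB : (S.col P.n).KummerB (S.D P.n)) (hΘ : ThetaPinned S P ρ)
    (hscaled : ∀ (i : Fin T.lstar) (vQ : T.VQ),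
      (S.D P.n).logvol _ vQ (ρ (S.D P.n).Ψ (Setting.labelSucc i) vQ) =
        (((i : ℕ) + 1 : ℕ) : ℝ) ^ 2 * P.qLocal (Setting.labelSucc i) vQ)
    (i : Fin T.lstar) (vQ : T.VQ) :
    (S.D P.n).logvol _ vQ (P.thetaRegion3 (Setting.labelSucc i) vQ) -
        (((i : ℕ) + 1 : ℕ) : ℝ) ^ 2 * P.qLocal (Setting.labelSucc i) vQ = 0 := by
  rw [thetaRegion3_eq_of_thetaPinned S P ρ hKumB hΘ, hscaled i vQ, sub_self]

/-- **Channel 3 is NONNEGATIVE over an honest image** (pin-free): with monotone log-volume, admissible Θ-regions and the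
(Ind3)-enlarged region admissible, if ONE Kummer image `thetaRegion m₀` inside the (Ind3)-union is honestly scaled
(`logvol = j²·qLocal`, [IUTchIV] Step (v)), then `logvol thetaRegion3 − j²·qLocal ≥ 0` — (Ind3) can only ADD volume over the honest image
(print's «upper semi-compatibility», p. 156). [claim: Mochizuki2012, status: disputed] -/
theorem ind3Channel_nonneg_of_honestImage (hmono : LogvolMono P) (hadm : ThetaRegionsAdm P)
    (hadm3 : ∀ (i : Fin T.lstar) (vQ : T.VQ), (S.D P.n).Adm _ vQ (P.thetaRegion3 (Setting.labelSucc i) vQ))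
    (m₀ : ℤ)
    (hscaled0 : ∀ (i : Fin T.lstar) (vQ : T.VQ),
      (S.D P.n).logvol _ vQ (P.thetaRegion m₀ (Setting.labelSucc i) vQ) =
        (((i : ℕ) + 1 : ℕ) : ℝ) ^ 2 * P.qLocal (Setting.labelSucc i) vQ)
    (i : Fin T.lstar) (vQ : T.VQ) :
    0 ≤ (S.D P.n).logvol _ vQ (P.thetaRegion3 (Setting.labelSucc i) vQ) -
        (((i : ℕ) + 1 : ℕ) : ℝ) ^ 2 * P.qLocal (Setting.labelSucc i) vQ := by
  have hsub : P.thetaRegion m₀ (Setting.labelSucc i) vQ ⊆ P.thetaRegion3 (Setting.labelSucc i) vQ :=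
    Set.subset_iUnion (fun m : ℤ => P.thetaRegion m (Setting.labelSucc i) vQ) m₀
  have h := hmono i vQ (hadm m₀ i vQ) (hadm3 i vQ) hsub
  rw [hscaled0 i vQ] at h
  linarith

/-- Under the bridge hypotheses the (Ind3)-enlarged regions are admissible (they are possible images). [folklore] -/
theorem thetaRegion3_adm (HB : BridgeHyps P) (i : Fin T.lstar) (vQ : T.VQ) :
    (S.D P.n).Adm _ vQ (P.thetaRegion3 (Setting.labelSucc i) vQ) :=
  HB.image_adm i vQ _ (P.thetaRegion3_mem_possibleImages _ vQ)

/-! ## 3. Capping both channels: the class-(i) barrier -/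

/-- **TWO CAPS BELOW THE BUDGET REFUTE THE COROLLARY.** For every setting with `ThetaFinite` and a label-independent q-volume: if channel
12 (hull over (Ind3)-union) is capped by `s₁₂` and channel 3 ((Ind3)-union over the honest single-image volume `j²·qLocal`) by `s₃`,
packetwise at the labels of `𝔽_l^⋇`, and `PN(Σᶠ (s₁₂ + s₃)) < (PN(j²) − 1)·|log(q)|`, then the typed Corollary FAILS. Reading for class (i)
candidates: an (Ind3)/«upper semi-compatibility» repair whose gain over the honest image is bounded by log-shell data cannot supply the
Statement at large `|log(q)|` unless the (Ind1),(Ind2)-union + hull supplies a height-sized remainder. [claim: Mochizuki2012, status: disputed] -/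
theorem not_statement_of_channelCaps_lt (hfin : P.ThetaFinite)
    (hindep : ∀ (i i' : Fin T.lstar) (vQ : T.VQ), P.qLocal (Setting.labelSucc i) vQ = P.qLocal (Setting.labelSucc i') vQ)
    (s₁₂ s₃ : Fin T.lstar → T.VQ → ℝ) (hs₁₂ : ∀ i, (Function.support (s₁₂ i)).Finite)
    (hs₃ : ∀ i, (Function.support (s₃ i)).Finite)
    (hcap₁₂ : ∀ (i : Fin T.lstar) (vQ : T.VQ),
      (S.D P.n).logvol _ vQ (P.thetaHull (Setting.labelSucc i) vQ) -
        (S.D P.n).logvol _ vQ (P.thetaRegion3 (Setting.labelSucc i) vQ) ≤ s₁₂ i vQ)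
    (hcap₃ : ∀ (i : Fin T.lstar) (vQ : T.VQ),
      (S.D P.n).logvol _ vQ (P.thetaRegion3 (Setting.labelSucc i) vQ) -
        (((i : ℕ) + 1 : ℕ) : ℝ) ^ 2 * P.qLocal (Setting.labelSucc i) vQ ≤ s₃ i vQ)
    (hlt : processionNormalized (fun i : Fin T.lstar => ∑ᶠ vQ : T.VQ, (s₁₂ i vQ + s₃ i vQ)) <
      (processionNormalized (fun i : Fin T.lstar => (((i : ℕ) + 1 : ℕ) : ℝ) ^ 2) - 1) * (-P.negLogQ)) :
    ¬ P.Statement :=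
  not_statement_of_excessCap_lt S P hfin hindep (fun i vQ => s₁₂ i vQ + s₃ i vQ)
    (fun i => Function.HasFiniteSupport.add (hs₁₂ i) (hs₃ i))
    (fun i vQ => by linarith [hcap₁₂ i vQ, hcap₃ i vQ]) hlt

/-- **Dually: the Corollary with both channels capped bounds the height** — `Statement ⟹ (PN(j²) − 1)·|log(q)| ≤ PN(Σᶠ (s₁₂ + s₃))`;
with channel 3 closed by the Θ-pin (`ind3Channel_eq_zero_of_thetaPinned`, `s₃ = 0`) this is p427951's `height_le_of_inflationCap`.
[claim: Mochizuki2012, status: disputed] -/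
theorem height_le_of_channelCaps (hfin : P.ThetaFinite)
    (hindep : ∀ (i i' : Fin T.lstar) (vQ : T.VQ), P.qLocal (Setting.labelSucc i) vQ = P.qLocal (Setting.labelSucc i') vQ)
    (s₁₂ s₃ : Fin T.lstar → T.VQ → ℝ) (hs₁₂ : ∀ i, (Function.support (s₁₂ i)).Finite)
    (hs₃ : ∀ i, (Function.support (s₃ i)).Finite)
    (hcap₁₂ : ∀ (i : Fin T.lstar) (vQ : T.VQ),
      (S.D P.n).logvol _ vQ (P.thetaHull (Setting.labelSucc i) vQ) -
        (S.D P.n).logvol _ vQ (P.thetaRegion3 (Setting.labelSucc i) vQ) ≤ s₁₂ i vQ)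
    (hcap₃ : ∀ (i : Fin T.lstar) (vQ : T.VQ),
      (S.D P.n).logvol _ vQ (P.thetaRegion3 (Setting.labelSucc i) vQ) -
        (((i : ℕ) + 1 : ℕ) : ℝ) ^ 2 * P.qLocal (Setting.labelSucc i) vQ ≤ s₃ i vQ)
    (hS : P.Statement) :
    (processionNormalized (fun i : Fin T.lstar => (((i : ℕ) + 1 : ℕ) : ℝ) ^ 2) - 1) * (-P.negLogQ) ≤
      processionNormalized (fun i : Fin T.lstar => ∑ᶠ vQ : T.VQ, (s₁₂ i vQ + s₃ i vQ)) :=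
  height_le_of_excessCap S P hfin hindep (fun i vQ => s₁₂ i vQ + s₃ i vQ)
    (fun i => Function.HasFiniteSupport.add (hs₁₂ i) (hs₃ i))
    (fun i vQ => by linarith [hcap₁₂ i vQ, hcap₃ i vQ]) hS

end Summit.ABC.IUTFork.Cor312Vol.PinnedHonest

end
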